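import Literature.AnabelianGeometry.AbsoluteAnabelian.MLFGaloisElasticProofs
import Literature.AnabelianGeometry.AbsoluteAnabelian.SubpadicSlimProofs
import Literature.AnabelianGeometry.AbsoluteAnabelian.SubpadicExamples
import Mathlib.GroupTheory.Nilpotent
import HarnessLib

/-!
# `G_K` (`K/ℚ_p` finite) has no non-trivial topologically finitely generated closed abelian subgroup that is
# normal in an open subgroup — from ELASTICITY + SLIMNESS (proof-only)

S. Mochizuki, *Topics in Absolute Anabelian Geometry I: Generalities* (2012) [AbsTopI], Thm 1.7 (ii) p. 14
("If `k` is an MLF, then `G_k` is elastic") [cite: MochizukiAbsTopI2012, Thm 1.7 (ii) p.14] and Def 1.1 (ii) p. 10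
(elastic) [cite: MochizukiAbsTopI2012, Def 1.1 (ii) p.10]; S. Mochizuki, *The local pro-p anabelian geometry of
curves* (1999) [pGC], Lemma 15.8 p. 80 (`G_K` is slim for `K` sub-`p`-adic) [cite: MochizukiLocAn1999, Lem 15.8 p.80];
J. Neukirch, A. Schmidt, K. Wingberg, *Cohomology of Number Fields*, (7.5.x): structure of `G_k` for `p`-adic `k`
[cite: NeukirchSchmidtWingberg2008, Ch. VII §5].

abc-iut cell, layer L6 (loan of the L4 engines), seat abc-iut-w5-d204 (gen 8), row «GK-NO-ABELIAN-NORMAL»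
(abc-iut-L6-lead §F v1.19dn 2026-08-27T03:01:52Z: the (G) residual of abc-iut-w5-d187's «COR219III-M1b-EVEN (β)» —
«G_K has no non-trivial closed normal abelian subgroup» — as a THEOREM ATTEMPT from the tree's engines
`isElastic_absoluteGaloisGroup` (abc-iut-w5-d206 / abc-iut-L4-t15, `MLFGaloisElasticProofs`) and
`IsSubpadicFor.isSlimGroup_absoluteGaloisGroup` (`SubpadicSlimProofs`)).  PROOF-ONLY (no definition, no instance,
no `Prop`-valued fact).  WHAT THE TWO ENGINES GIVE, EXACTLY (numbers, not adjectives):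

* `isSlimGroup_absoluteGaloisGroup_of_finiteDimensional` — `G_K` is slim for every finite extension `K/ℚ_p`
  (sub-`p`-adicity of finite extensions of `ℚ_p`, by name);
* `eq_bot_of_isOpen_of_comm` — **`G_K` has NO open abelian subgroup except in the degenerate reading `U = ⊥`**
  (an abelian `U` lies in its own centraliser, which slimness kills);
* `eq_bot_of_comm_of_normal_subgroupOf_of_tfg` — **THE TFG FORM: every TOPOLOGICALLY FINITELY GENERATED closed
  abelian subgroup `N` of `G_K` that is normal in some OPEN subgroup `H ⊇ N` is trivial** (elasticity: `N = ⊥` or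
  `[G_K : N] < ∞`; a closed subgroup of finite index is open; then the previous item);
* `eq_bot_of_comm_of_normal_of_tfg` — the `H = G_K` case: no non-trivial tfg closed abelian NORMAL subgroup;
* `isTopologicallyFinitelyGenerated_topologicalClosure_zpowers` (general topological groups) and
  `eq_one_of_normal_topologicalClosure_zpowers` — **the PROCYCLIC case: if the closed procyclic subgroup
  `closure ⟨x⟩` is normal in some open subgroup of `G_K`, then `x = 1`** (covers cyclotome-shaped, `Ẑ(1)`-shaped and
  centre-shaped candidates, which are topologically generated by one element).

HONEST RESIDUAL (desk sizing, for the GAP-LEDGER if the consumer needs it): the UNRESTRICTED statement «every closed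
abelian normal subgroup of `G_K` is trivial» (true classically: `cd = 2` + torsion-freeness force an abelian closed
normal pro-`ℓ` subgroup to be `ℤ_ℓ^{≤ 2}`, hence tfg, hence the TFG form applies — [NeukirchSchmidtWingberg2008] Ch. VII §5) is NOT
derived here: slimness alone is void for it (the affine group `ℤ_p ⋊ ℤ_p^×` is slim with the abelian normal
subgroup `ℤ_p`) and elasticity needs the finite-generation input; the missing tree input is «`cd_ℓ(G_K) ≤ 2` and
`G_K` torsion-free» or any statement forcing closed abelian subgroups of `G_K` to be topologically finitely generated.
Classical; nothing in this file bears on [IUTchIII] Cor. 3.12; typed ≠ proved; nothing here says abc is proved or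
refuted.
-/

noncomputable section

open Topology Field

namespace Literature.AnabelianGeometry.AbsoluteAnabelian

open Literature.AlgebraicGeometry.Frobenioids (IsSlimGroup)

/-! ### General topological groups: abelian subgroups, centralisers, procyclic closures -/

section General

variable {G : Type*} [Group G]

/-- An abelian subgroup lies in its own centraliser. [folklore] [cite: NeukirchSchmidtWingberg2008, Ch. VII §5] -/
theorem le_centralizer_self_of_comm (N : Subgroup G) (h : ∀ a ∈ N, ∀ b ∈ N, a * b = b * a) :
    N ≤ Subgroup.centralizer (N : Set G) :=
  fun x hx => Subgroup.mem_centralizer_iff.mpr fun y hy => h y hy x hx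

variable [TopologicalSpace G] [IsTopologicalGroup G]

/-- **The closure of a cyclic subgroup is topologically finitely generated** (by the one element).
[cite: MochizukiAbsTopI2012, Def 1.1 (ii) p.10] -/
theorem isTopologicallyFinitelyGenerated_topologicalClosure_zpowers (x : G) :
    IsTopologicallyFinitelyGenerated ((Subgroup.zpowers x).topologicalClosure) := by
  classical
  set N : Subgroup G := (Subgroup.zpowers x).topologicalClosure with hN
  have hxN : x ∈ N := Subgroup.le_topologicalClosure _ (Subgroup.mem_zpowers x)
  refine ⟨{⟨x, hxN⟩}, ?_⟩
  rw [Finset.coe_singleton, ← Subgroup.zpowers_eq_closure]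
  -- the closure in `N` of `⟨⟨x⟩⟩` is everything: pull back the closure in `G` along the embedding
  refine top_le_iff.mp fun y _ => ?_
  change y ∈ _root_.closure ((Subgroup.zpowers (⟨x, hxN⟩ : N) : Set N))
  rw [Topology.IsInducing.subtypeVal.closure_eq_preimage_closure_image, Set.mem_preimage]
  have hsub : (Subgroup.zpowers x : Set G) ⊆ Subtype.val '' ((Subgroup.zpowers (⟨x, hxN⟩ : N) : Set N)) := by
    rintro _ ⟨k, rfl⟩
    exact ⟨⟨x, hxN⟩ ^ k, ⟨k, rfl⟩, by simp⟩
  exact closure_mono hsub y.2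

/-- The closure of a cyclic subgroup is abelian (Hausdorff groups). [folklore] [cite: NeukirchSchmidtWingberg2008, Ch. VII §5] -/
theorem comm_of_mem_topologicalClosure_zpowers [T2Space G] (x : G) :
    ∀ a ∈ (Subgroup.zpowers x).topologicalClosure, ∀ b ∈ (Subgroup.zpowers x).topologicalClosure,
      a * b = b * a := by
  have hs : ∀ u v : Subgroup.zpowers x, u * v = v * u := by
    rintro ⟨u, ⟨k, rfl⟩⟩ ⟨v, ⟨m, rfl⟩⟩
    exact Subtype.ext (zpow_mul_comm x k m)
  letI : CommGroup ((Subgroup.zpowers x).topologicalClosure) := Subgroup.commGroupTopologicalClosure _ hs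
  intro a ha b hb
  exact congrArg Subtype.val (mul_comm (⟨a, ha⟩ : (Subgroup.zpowers x).topologicalClosure) ⟨b, hb⟩)

end General

/-! ### `G_K`, `K/ℚ_p` finite: slim + elastic ⇒ no tfg abelian subgroup normal in an open subgroup -/

variable (p : ℕ) [Fact p.Prime] (K : Type) [Field K] [Algebra ℚ_[p] K] [FiniteDimensional ℚ_[p] K]

include p

/-- `G_K` is slim for every finite extension `K/ℚ_p` ([pGC] Lem 15.8 at a finite, hence sub-`p`-adic, extension
of `ℚ_p`; tree theorems `IsSubpadicFor.padic`, `.of_finite`, `.isSlimGroup_absoluteGaloisGroup` by name).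
[cite: MochizukiLocAn1999, Lem 15.8 p.80] -/
theorem isSlimGroup_absoluteGaloisGroup_of_finiteDimensional : IsSlimGroup (absoluteGaloisGroup K) :=
  IsSubpadicFor.isSlimGroup_absoluteGaloisGroup ((AbsTopIII.IsSubpadicFor.padic p).of_finite (F := K))

/-- **No open abelian subgroup**: an OPEN subgroup `U ⊆ G_K` on which multiplication is commutative is `⊥`
(so, `G_K` being infinite and Hausdorff, there is none) — `U ⊆ Z_{G_K}(U) = 1` by slimness.
[cite: MochizukiLocAn1999, Lem 15.8 p.80] -/
theorem eq_bot_of_isOpen_of_comm (U : Subgroup (absoluteGaloisGroup K))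
    (hU : IsOpen (U : Set (absoluteGaloisGroup K))) (hcomm : ∀ a ∈ U, ∀ b ∈ U, a * b = b * a) : U = ⊥ :=
  le_bot_iff.mp (((isSlimGroup_absoluteGaloisGroup_of_finiteDimensional p K).centralizer_eq_bot U hU) ▸
    le_centralizer_self_of_comm U hcomm)

/-- **THE TFG FORM.** For `K/ℚ_p` finite, an open subgroup `H ⊆ G_K` and a subgroup `N ⊆ H` which is normal in `H`,
closed, TOPOLOGICALLY FINITELY GENERATED and abelian: `N = ⊥`.  (Elasticity [AbsTopI] Thm 1.7 (ii): `N = ⊥` or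
`[G_K : N] < ∞`; in the latter case `N` is closed of finite index hence open, and slimness [pGC] Lem 15.8 kills an
open abelian subgroup.) [cite: MochizukiAbsTopI2012, Thm 1.7 (ii) p.14] -/
theorem eq_bot_of_comm_of_normal_subgroupOf_of_tfg (H N : Subgroup (absoluteGaloisGroup K))
    (hH : IsOpen (H : Set (absoluteGaloisGroup K))) (hNH : N ≤ H) (hNn : (N.subgroupOf H).Normal)
    (hNc : IsClosed (N : Set (absoluteGaloisGroup K))) (hNfg : IsTopologicallyFinitelyGenerated N)
    (hcomm : ∀ a ∈ N, ∀ b ∈ N, a * b = b * a) : N = ⊥ := by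
  rcases (isElastic_absoluteGaloisGroup p K).eq_bot_or_finiteIndex H N hH hNH hNn hNc hNfg with h | h
  · exact h
  · haveI := h
    exact eq_bot_of_isOpen_of_comm p K N (N.isOpen_of_isClosed_of_finiteIndex hNc) hcomm

/-- **No non-trivial tfg closed abelian NORMAL subgroup of `G_K`** (the case `H = G_K`).
[cite: MochizukiAbsTopI2012, Thm 1.7 (ii) p.14] -/
theorem eq_bot_of_comm_of_normal_of_tfg (N : Subgroup (absoluteGaloisGroup K)) (hNn : N.Normal)
    (hNc : IsClosed (N : Set (absoluteGaloisGroup K))) (hNfg : IsTopologicallyFinitelyGenerated N)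
    (hcomm : ∀ a ∈ N, ∀ b ∈ N, a * b = b * a) : N = ⊥ :=
  eq_bot_of_comm_of_normal_subgroupOf_of_tfg p K ⊤ N (by rw [Subgroup.coe_top]; exact isOpen_univ) le_top
    (hNn.subgroupOf ⊤) hNc hNfg hcomm

/-- **THE PROCYCLIC CASE.** If the closed procyclic subgroup `closure ⟨x⟩ ⊆ G_K` is contained and normal in some
open subgroup `H`, then `x = 1`: no element `x ≠ 1` of `G_K` topologically generates a subgroup normalised by an
open subgroup (cyclotome-shaped / centre-shaped abelian normal subgroups are excluded).
[cite: MochizukiAbsTopI2012, Thm 1.7 (ii) p.14] -/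
theorem eq_one_of_normal_topologicalClosure_zpowers (H : Subgroup (absoluteGaloisGroup K))
    (hH : IsOpen (H : Set (absoluteGaloisGroup K))) (x : absoluteGaloisGroup K)
    (hxH : (Subgroup.zpowers x).topologicalClosure ≤ H)
    (hn : (((Subgroup.zpowers x).topologicalClosure).subgroupOf H).Normal) : x = 1 := by
  have h := eq_bot_of_comm_of_normal_subgroupOf_of_tfg p K H _ hH hxH hn
    (Subgroup.isClosed_topologicalClosure _) (isTopologicallyFinitelyGenerated_topologicalClosure_zpowers x)
    (comm_of_mem_topologicalClosure_zpowers x)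
  have hx : x ∈ (Subgroup.zpowers x).topologicalClosure :=
    Subgroup.le_topologicalClosure _ (Subgroup.mem_zpowers x)
  rw [h] at hx
  exact Subgroup.mem_bot.mp hx

/-- **No non-trivial closed procyclic NORMAL subgroup of `G_K`**: if `closure ⟨x⟩ ⊴ G_K` then `x = 1`.
[cite: MochizukiAbsTopI2012, Thm 1.7 (ii) p.14] -/
theorem eq_one_of_normal_topologicalClosure_zpowers_top (x : absoluteGaloisGroup K)
    (hn : ((Subgroup.zpowers x).topologicalClosure).Normal) : x = 1 :=
  eq_one_of_normal_topologicalClosure_zpowers p K ⊤ (by rw [Subgroup.coe_top]; exact isOpen_univ) x le_top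
    (hn.subgroupOf ⊤)

/-! ### v2 (append-only): the NILPOTENT (Fitting-shape) twin and the transport to continuous images -/

/-- **THE TFG NILPOTENT FORM (Fitting shape).** For `K/ℚ_p` finite, an open subgroup `H ⊆ G_K` and a subgroup
`N ⊆ H`, normal in `H`, closed, topologically finitely generated and NILPOTENT: `N = ⊥`.  (Elasticity: `N = ⊥` or of
finite index; a closed finite-index subgroup is open; by slimness the centre of an open subgroup lies in
`Z_{G_K}(N) = 1`; a nilpotent group with trivial centre is trivial — Mathlib `Group.IsNilpotent.center_ne_bot`.)
[cite: MochizukiAbsTopI2012, Thm 1.7 (ii) p.14] -/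
theorem eq_bot_of_isNilpotent_of_normal_subgroupOf_of_tfg (H N : Subgroup (absoluteGaloisGroup K))
    (hH : IsOpen (H : Set (absoluteGaloisGroup K))) (hNH : N ≤ H) (hNn : (N.subgroupOf H).Normal)
    (hNc : IsClosed (N : Set (absoluteGaloisGroup K))) (hNfg : IsTopologicallyFinitelyGenerated N)
    (hnil : Group.IsNilpotent N) : N = ⊥ := by
  rcases (isElastic_absoluteGaloisGroup p K).eq_bot_or_finiteIndex H N hH hNH hNn hNc hNfg with h | h
  · exact h
  · haveI := h
    have hNo : IsOpen (N : Set (absoluteGaloisGroup K)) := N.isOpen_of_isClosed_of_finiteIndex hNc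
    have hcen := (isSlimGroup_absoluteGaloisGroup_of_finiteDimensional p K).centralizer_eq_bot N hNo
    by_contra hne
    haveI : Nontrivial N := (Subgroup.nontrivial_iff_ne_bot N).mpr hne
    refine Group.IsNilpotent.center_ne_bot (G := N) (le_bot_iff.mp fun z hz => ?_)
    have hzc : (z : absoluteGaloisGroup K) ∈ Subgroup.centralizer (N : Set (absoluteGaloisGroup K)) :=
      Subgroup.mem_centralizer_iff.mpr fun y hy =>
        congrArg Subtype.val (Subgroup.mem_center_iff.mp hz ⟨y, hy⟩)
    rw [hcen] at hzc
    exact Subgroup.mem_bot.mpr (Subtype.ext (Subgroup.mem_bot.mp hzc))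

/-- **No non-trivial tfg closed nilpotent NORMAL subgroup of `G_K`** (the case `H = G_K`): the Fitting subgroup of
`G_K` computed over topologically finitely generated closed normal subgroups is trivial.
[cite: MochizukiAbsTopI2012, Thm 1.7 (ii) p.14] -/
theorem eq_bot_of_isNilpotent_of_normal_of_tfg (N : Subgroup (absoluteGaloisGroup K)) (hNn : N.Normal)
    (hNc : IsClosed (N : Set (absoluteGaloisGroup K))) (hNfg : IsTopologicallyFinitelyGenerated N)
    (hnil : Group.IsNilpotent N) : N = ⊥ :=
  eq_bot_of_isNilpotent_of_normal_subgroupOf_of_tfg p K ⊤ N (by rw [Subgroup.coe_top]; exact isOpen_univ) le_top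
    (hNn.subgroupOf ⊤) hNc hNfg hnil

/-- **TRANSPORT TO CONTINUOUS IMAGES** (the consumer shape `γ(Δ^Θ ∩ Π)`-type subgroups): for a COMPACT,
topologically finitely generated group `A` on which multiplication is commutative and a continuous homomorphism
`f : A → G_K` whose image is contained and normal in an open subgroup `H ⊆ G_K`, the image is trivial — the image
is closed (compact in a Hausdorff group), tfg (image of tfg) and abelian, so the TFG form applies.
[cite: MochizukiAbsTopI2012, Thm 1.7 (ii) p.14] -/
theorem range_eq_bot_of_comm_of_tfg {A : Type*} [Group A] [TopologicalSpace A] [IsTopologicalGroup A]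
    [CompactSpace A] (hA : IsTopologicallyFinitelyGenerated A) (hcomm : ∀ a b : A, a * b = b * a)
    (f : A →ₜ* absoluteGaloisGroup K) (H : Subgroup (absoluteGaloisGroup K))
    (hH : IsOpen (H : Set (absoluteGaloisGroup K))) (hfH : f.toMonoidHom.range ≤ H)
    (hn : ((f.toMonoidHom.range).subgroupOf H).Normal) : f.toMonoidHom.range = ⊥ := by
  -- the image is closed
  have hc : IsClosed ((f.toMonoidHom.range : Subgroup (absoluteGaloisGroup K)) : Set (absoluteGaloisGroup K)) := by
    rw [MonoidHom.coe_range]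
    exact (isCompact_range f.continuous).isClosed
  -- the image is topologically finitely generated
  let g : A →ₜ* f.toMonoidHom.range :=
    { toMonoidHom := f.toMonoidHom.rangeRestrict
      continuous_toFun := f.continuous.subtype_mk _ }
  have hfg : IsTopologicallyFinitelyGenerated f.toMonoidHom.range :=
    hA.of_surjective g f.toMonoidHom.rangeRestrict_surjective
  -- the image is abelian
  have hab : ∀ a ∈ f.toMonoidHom.range, ∀ b ∈ f.toMonoidHom.range, a * b = b * a := by
    rintro _ ⟨a, rfl⟩ _ ⟨b, rfl⟩
    change f a * f b = f b * f a
    rw [← map_mul, hcomm, map_mul]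
  exact eq_bot_of_comm_of_normal_subgroupOf_of_tfg p K H _ hH hfH hn hc hfg hab

/-- Transport, `H = G_K`: a continuous homomorphism from a compact tfg abelian group into `G_K` with NORMAL image is
trivial. [cite: MochizukiAbsTopI2012, Thm 1.7 (ii) p.14] -/
theorem range_eq_bot_of_comm_of_tfg_of_normal {A : Type*} [Group A] [TopologicalSpace A] [IsTopologicalGroup A]
    [CompactSpace A] (hA : IsTopologicallyFinitelyGenerated A) (hcomm : ∀ a b : A, a * b = b * a)
    (f : A →ₜ* absoluteGaloisGroup K) (hn : (f.toMonoidHom.range).Normal) : f.toMonoidHom.range = ⊥ :=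
  range_eq_bot_of_comm_of_tfg p K hA hcomm f ⊤ (by rw [Subgroup.coe_top]; exact isOpen_univ) le_top
    (hn.subgroupOf ⊤)

end Literature.AnabelianGeometry.AbsoluteAnabelian

end
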